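import Summits.BirchSwinnertonDyer.BirchSwinnertonDyer.Theorems.ErratumRoadFiveNonSurjCornerFiveInstanceEstar
import HarnessLib

/-!
# Route `ErratumRoadFive` (rung K2), crux `NonSurjCorner` (item stmt-BirchSwinnertonDyer-19065), gen-3 DEEP children
# 23046 `NonSurjCornerKolyZDeep` ∕ 23047 `NonSurjCornerTwinMuAnDeep`: NEW DEEP CORNER PAIRS AT `p = 5` BEYOND THE CENSUS BOX AS KERNEL INSTANCES,
# PART B: the pairs at `t = −13/5` (`d = 73`) and `t = −231/115` (`d = 47`)
# (cell `bsd-stepL`, seat `bsd-stepL-corner5-p2` g15, WIDTH-LEVER lane B; `--supports stmt-BirchSwinnertonDyer-23047 --as helper`)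

WHY ∕ METHOD ∕ VERIFICATION: see part A (`…FiveInstancesDeepBeyondA.lean`) — lane B g15's deep hunt beyond the census box (kit j331491: the 7 124
root-number −1 members of Zywina's `X_{G₉}` family with `4·10¹⁰ < N ≤ 10¹²`, `|d| ≤ 100`; `ellrank` + saturation + `ellL1`, `#Ш_an = X∕ĥ`) found FOUR
pairs with `#Ш_an = 25`, re-verified at 38 digits by kit j331690 (`ellanalyticrank` = 1, `L'` = `ellL1` = `lfun` to 37 digits, `ellrank` = `[1,1,0]`,
generator saturated at every prime ≤ 500, `#Ш_an = 25.000000000000000000000000000000000000`).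
All four have the shape of `E*`: image `5S4`, NON-split multiplicative at `5`, Tamagawa exponent `t = ord₅ ∏c = 0`, trivial torsion.
THIS FILE (part B): the third and fourth new pairs as BY-NAME kernel instances, template and conventions of part A ∕ `…FiveInstanceEstar`
(algebraic hypotheses decided in the kernel; `¬ Surj` a theorem via `j = J₉(t)`; the analytic binders `hr`, `hSha` displayed). The fourth pair has a
SECOND multiplicative prime, `23` (non-split, `ord₂₃ Δ_min = 5`, so still no (ram) witness) — the first deep pair with a multiplicative prime `≠ 5`.
* `J9t-13o5d73` (namespace `Tm13o5d73`): `t = -13/5`, `[0, 1, 0, -34107376, -151657428560]`, `N = 465014721640 = 2³·5·7²·73²·211²`, `ord₅ Δ_min = 5` — `5` the only multiplicative prime; numerics `L'(E,1) = 28.4533413…`, `ĥ = 9.6341300…`, `X = 240.8532499…`, `#Ш_an = 25.0000…`; first Heegner fields `d_K = -111, -439, -479, -839, …`.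
* `J9t-231o115d47` (namespace `Tm231o115d47`): `t = -231/115`, `[0, 0, 0, -298683308, -5358002282132]`, `N = 783326067760 = 2⁴·5·23·47²·439²`, `ord₅ Δ_min = 5` — a second (NON-split) multiplicative prime `23` with `ord₂₃ Δ_min = 5`; numerics `L'(E,1) = 19.8265473…`, `ĥ = 23.8247627…`, `X = 595.6190680…`, `#Ш_an = 25.0000…`; first Heegner fields `d_K = -359, -631, -751, -919, …`.

HONEST FRAMING: theorems about explicit curves only; no definition, no named fact, no `sorry`; CONDITIONAL only on the displayed analytic binders
where they appear; nothing is booked; 23046 ∕ 23047 ∕ 19065 stay OPEN (class-wide: Kolyvagin's refined conjecture ∕ Greenberg's Conj. 1.11 at a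
non-surjective irreducible image with `p ∥ N`); BSD is proved for no curve; no census word, tier or label moves (T7). What moves is the deep children's
KNOWN POPULATION at `p = 5`: 1 pair → 5 pairs (memo `HOME/corner5/g15/CORNER5-P2-G15.md`; data `HOME/corner5/g15/data/hunt5/` — HUNT5-P2-N1e12.census.tsv,
VERIFY4.out). Their Friedberg–Hoffstein twins' μ symbol tables (23047's clause pair by pair) follow in `…TwinMuAnTablesDeepBeyond…` (kit j331757).

References: as in part A. -/

set_option linter.dupNamespace false
set_option autoImplicit false

noncomputable section
open scoped Classical
open WeierstrassCurve Literature.NumberTheory.EllipticCurves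
  Literature.NumberTheory.EllipticCurves.Rank1Residual
  Literature.NumberTheory.EllipticCurves.Rank1Residual.X11RankOneCertificates
  Summit.BirchSwinnertonDyer.BirchSwinnertonDyer.Rank1Residual.IntModel
  Summit.BirchSwinnertonDyer.Rank1Residual Summit.BirchSwinnertonDyer.Rank1Residual.X11b

namespace Summit.BirchSwinnertonDyer.BirchSwinnertonDyer.Theorems.CornerFive

/-! ## Kernel pair facts of `E₀ = [0, 1, 0, -34107376, -151657428560]` (`J9t-13o5d73`, `j = J₉(-13/5)`, `N = 465014721640 = 2³·5·7²·73²·211²`) at `p = 5` -/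

namespace Tm13o5d73

/-- `Δ(E₀) = -7395136074861155734400000`. [cite: SilvermanAEC2009, III.1] -/
theorem Δ_eq : (⟨0, 1, 0, -34107376, -151657428560⟩ : WeierstrassCurve ℤ).Δ = -7395136074861155734400000 := by
  decide

/-- `Δ(E₀) = -2¹⁰·5⁵·7³·73⁶·211²` (bad primes `2, 5, 7, 73, 211`; `N = 2³·5·7²·73²·211²`). [cite: SilvermanAEC2009, VII.5 Prop. 5.1] -/
theorem Δ_eq_factored : (⟨0, 1, 0, -34107376, -151657428560⟩ : WeierstrassCurve ℤ).Δ =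
    -(2 ^ 10 * 5 ^ 5 * 7 ^ 3 * 73 ^ 6 * 211 ^ 2) := by
  rw [Δ_eq]; norm_num

/-- `c₄(E₀) = 1637154064 = 2⁴·7·13·73²·211`. [cite: SilvermanAEC2009, III.1] -/
theorem c₄_eq : (⟨0, 1, 0, -34107376, -151657428560⟩ : WeierstrassCurve ℤ).c₄ = 1637154064 := by
  decide

/-- `#Ẽ₀(𝔽_11) = 8` (`a_11 = 4`), kernel-decided. [cite: SilvermanAEC2009, V.2] -/
theorem card_F11 : Nat.card (((⟨0, 1, 0, -34107376, -151657428560⟩ : WeierstrassCurve ℤ).map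
    (Int.castRingHom (ZMod 11))).toAffine.Point) = 8 := by
  rw [@natCard_point_eq_one_add_card (ZMod 11) (@ZMod.instField 11 ⟨by norm_num⟩) _ _ _ (by decide)]
  decide

/-- `E` is an elliptic curve (`Δ ≠ 0`). [cite: SilvermanAEC2009, III.1] -/
theorem isElliptic (W : WeierstrassCurve ℚ) (hW : W = ⟨0, 1, 0, -34107376, -151657428560⟩) : W.IsElliptic := by
  subst hW; exact isElliptic_of_discOf_ne_zero 0 1 0 (-34107376) (-151657428560) (by decide +kernel)

/-- The model is GLOBALLY MINIMAL: `|Δ| < 128¹²` and `q¹² ∤ Δ` for every prime `q < 128` (all `ord_q Δ ≤ 10`).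
[cite: SilvermanAEC2009, VII.1 Remark 1.1] -/
theorem isGloballyMinimal (W : WeierstrassCurve ℚ) (hW : W = ⟨0, 1, 0, -34107376, -151657428560⟩) : W.IsGloballyMinimal := by
  subst hW
  exact CornerSeven.isGloballyMinimal_of_silverman_bounded 0 1 0 (-34107376) (-151657428560) 128
    (by decide +kernel) (by decide +kernel) (by decide +kernel)

/-- The tree's integral model of `E` is `E₀`. [folklore] -/
theorem integralModelInt_eq (W : WeierstrassCurve ℚ) (hW : W = ⟨0, 1, 0, -34107376, -151657428560⟩) [W.IsGloballyMinimal] :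
    integralModelInt W = ⟨0, 1, 0, -34107376, -151657428560⟩ := by
  subst hW; exact integralModelInt_eq_of_map_eq _ (map_mk_int _ _ _ _ _)

/-- `E` as the base change of its integer model. [folklore] -/
theorem eq_baseChange (W : WeierstrassCurve ℚ) (hW : W = ⟨0, 1, 0, -34107376, -151657428560⟩) :
    W = (⟨0, 1, 0, -34107376, -151657428560⟩ : WeierstrassCurve ℤ).baseChange ℚ := by
  rw [hW]; ext <;> simp [WeierstrassCurve.baseChange, WeierstrassCurve.map]

/-- **Multiplicative reduction at `5`** (`5 ∣ Δ`, `5 ∤ c₄`). [cite: SilvermanAEC2009, VII.5 Prop. 5.1(b)] -/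
theorem mult_five (W : WeierstrassCurve ℚ) (hW : W = ⟨0, 1, 0, -34107376, -151657428560⟩) [W.IsElliptic] [W.IsGloballyMinimal]
    [Fact (Nat.Prime 5)] : Mult W 5 :=
  hasMultiplicativeReductionAtPrime_of_intModel (integralModelInt_eq W hW) 5
    (by rw [Δ_eq]; decide) (by rw [c₄_eq]; decide)

/-- `ord₅ Δ_min(E) = 5`. [cite: SilvermanAEC2009, VII.5 Prop. 5.1(b)] -/
theorem padicValInt_five (W : WeierstrassCurve ℚ) (hW : W = ⟨0, 1, 0, -34107376, -151657428560⟩) [W.IsElliptic] [W.IsGloballyMinimal]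
    [Fact (Nat.Prime 5)] : padicValInt 5 W.minimalDiscriminantInt = 5 := by
  rw [minimalDiscriminantInt_eq (integralModelInt_eq W hW), Δ_eq]
  exact padicValInt_eq_of_dvd_of_not_dvd 5 (by decide) (by decide)

/-- The crux binder **`5 ∣ ord₅ Δ_min(E)`** (`5 = 5·1`). [cite: SilvermanAEC2009, VII.5 Prop. 5.1(b)] -/
theorem dvd_padicValInt_five (W : WeierstrassCurve ℚ) (hW : W = ⟨0, 1, 0, -34107376, -151657428560⟩) [W.IsElliptic] [W.IsGloballyMinimal]
    [Fact (Nat.Prime 5)] : (5 : ℕ) ∣ padicValInt 5 W.minimalDiscriminantInt := by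
  have h := padicValInt_five W hW
  omega

/-- **`E[5]` is irreducible**: Frobenius no-root witness at the good prime `ℓ = 11` (`a₁₁ = 4`, `X² − 4X + 11` root-free mod `5`;
Mazur 1978 Prop. 6.3 (1)). [cite: Mazur1978, §6 Prop. 6.3 (1) (p. 153)] -/
theorem irr_five (W : WeierstrassCurve ℚ) (hW : W = ⟨0, 1, 0, -34107376, -151657428560⟩) [W.IsElliptic] [W.IsGloballyMinimal]
    [Fact (Nat.Prime 5)] : Irr W 5 :=
  haveI : Fact (Nat.Prime 11) := ⟨by norm_num⟩
  hasIrreducibleModPGaloisRep_of_intModel_of_noroot (integralModelInt_eq W hW) 5 11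
    (by decide) (by rw [Δ_eq]; decide) card_F11
    (of_decide_eq_true rfl)

/-- **Every prime of multiplicative reduction of `E` is `5`**: it divides `Δ = -2¹⁰·5⁵·7³·73⁶·211²`, and `2`, `7`, `73`, `211` are additive
(`q ∣ Δ`, `q ∣ c₄` at the globally minimal model). [cite: SilvermanAEC2009, VII.5 Prop. 5.1] -/
theorem eq_five_of_mult (W : WeierstrassCurve ℚ) (hW : W = ⟨0, 1, 0, -34107376, -151657428560⟩) [W.IsElliptic] [W.IsGloballyMinimal]
    {ℓ : ℕ} [hℓ : Fact ℓ.Prime] (hm : Mult W ℓ) : ℓ = 5 := by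
  have hI := integralModelInt_eq W hW
  have hdvd : (ℓ : ℤ) ∣ (⟨0, 1, 0, -34107376, -151657428560⟩ : WeierstrassCurve ℤ).Δ := by
    by_contra hnd
    exact (hasGoodReductionAtPrime_of_not_dvd W ℓ (by rwa [minimalDiscriminantInt_eq hI])).not_hasMultiplicativeReduction _ hm
  rw [Δ_eq_factored, Int.dvd_neg, Int.natCast_dvd] at hdvd
  simp only [Int.natAbs_mul, Int.natAbs_pow] at hdvd
  have hp := hℓ.out
  have hadd : ∀ q : ℕ, [Fact q.Prime] → (q : ℤ) ∣ (⟨0, 1, 0, -34107376, -151657428560⟩ : WeierstrassCurve ℤ).Δ →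
      (q : ℤ) ∣ (⟨0, 1, 0, -34107376, -151657428560⟩ : WeierstrassCurve ℤ).c₄ → ¬ Mult W q :=
    fun q _ hΔ hc ↦ not_hasMultiplicativeReductionAtPrime_of_intModel_of_dvd_of_dvd hI q hΔ hc
  rcases (Nat.Prime.dvd_mul hp).mp hdvd with hdvd | h211
  · rcases (Nat.Prime.dvd_mul hp).mp hdvd with hdvd | h73
    · rcases (Nat.Prime.dvd_mul hp).mp hdvd with hdvd | h7
      · rcases (Nat.Prime.dvd_mul hp).mp hdvd with hdvd | h5
        · exfalso
          have h' : ℓ = 2 := (Nat.prime_dvd_prime_iff_eq hp (by norm_num : Nat.Prime 2)).mp (hp.dvd_of_dvd_pow hdvd)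
          subst h'
          exact hadd 2 (by rw [Δ_eq]; decide) (by rw [c₄_eq]; decide) hm
        · exact (Nat.prime_dvd_prime_iff_eq hp (by norm_num : Nat.Prime 5)).mp (hp.dvd_of_dvd_pow h5)
      · exfalso
        have h' : ℓ = 7 := (Nat.prime_dvd_prime_iff_eq hp (by norm_num : Nat.Prime 7)).mp (hp.dvd_of_dvd_pow h7)
        subst h'
        exact hadd 7 (by rw [Δ_eq]; decide) (by rw [c₄_eq]; decide) hm
    · exfalso
      have h' : ℓ = 73 := (Nat.prime_dvd_prime_iff_eq hp (by norm_num : Nat.Prime 73)).mp (hp.dvd_of_dvd_pow h73)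
      subst h'
      exact hadd 73 (by rw [Δ_eq]; decide) (by rw [c₄_eq]; decide) hm
  · exfalso
    have h' : ℓ = 211 := (Nat.prime_dvd_prime_iff_eq hp (by norm_num : Nat.Prime 211)).mp (hp.dvd_of_dvd_pow h211)
    subst h'
    exact hadd 211 (by rw [Δ_eq]; decide) (by rw [c₄_eq]; decide) hm

/-- The crux binder **no (ram) witness at `5`**: `E` has no multiplicative prime other than `5`.
[cite: SkinnerUrban2014, Thm. 2 (p. 3), hypothesis (ram)] -/
theorem not_ram_five (W : WeierstrassCurve ℚ) (hW : W = ⟨0, 1, 0, -34107376, -151657428560⟩) [W.IsElliptic] [W.IsGloballyMinimal]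
    [Fact (Nat.Prime 5)] : ¬ Ram W 5 := by
  rintro ⟨ℓ, hℓ, hne, hm, -⟩
  exact hne (eq_five_of_mult W hW hm)

/-- **`j(E) = J₉(-13/5)`** on Zywina's `X_{G₉}` j-line: `j = c₄³/Δ = −1854268/3125 = t³(t² + 5t + 40)` at `t = -13/5`.
[cite: Zywina2015, §1.3 (J₉) and Thm. 1.4 (arXiv:1508.07660)] -/
theorem j_eq_J9 (W : WeierstrassCurve ℚ) (hW : W = ⟨0, 1, 0, -34107376, -151657428560⟩) [W.IsElliptic] :
    W.j = (-13 / 5 : ℚ) ^ 3 * ((-13 / 5 : ℚ) ^ 2 + 5 * (-13 / 5) + 40) := by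
  have hW' := eq_baseChange W hW
  subst hW'
  rw [j_baseChange_int, c₄_eq, Δ_eq]; norm_num

/-- **`ρ̄_{E,5}` is NOT onto** — a THEOREM: `E` is non-CM (multiplicative at `5`) and `j(E) = J₉(-13/5)`, so the tree's
`zywina2015_thm14_not_surjective_five_of_j_eq_J9_holds` applies. [cite: Zywina2015, Thm. 1.4 (i = 9) (arXiv:1508.07660)]
[cite: SilvermanATAEC1994, Thm. II.6.4] -/
theorem not_surj_five (W : WeierstrassCurve ℚ) (hW : W = ⟨0, 1, 0, -34107376, -151657428560⟩) [W.IsElliptic] [W.IsGloballyMinimal]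
    [Fact (Nat.Prime 5)] : ¬ Surj W 5 :=
  zywina2015_thm14_not_surjective_five_of_j_eq_J9_holds W
    (fun hCM ↦ not_hasMultiplicativeReductionAtPrime_of_hasCM W hCM 5 (mult_five W hW)) (-13 / 5) (j_eq_J9 W hW)

/-- **`(E, 5) ∈ X11b`** given `r_an(E) = 1` (`hr`; numerics: root number `−1`, `L'(E,1) = 28.4533413…`, `ellrank` = `[1,1,0]`, lane B g15 kit j331690).
[cite: Miller2011LMS, §1] -/
theorem classX11b_five (W : WeierstrassCurve ℚ) (hW : W = ⟨0, 1, 0, -34107376, -151657428560⟩) [W.IsElliptic] [W.IsGloballyMinimal]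
    [Fact (Nat.Prime 5)] (hr : W.analyticRank = 1) : ClassX11b W 5 :=
  ⟨hr, by decide, mult_five W hW, irr_five W hW⟩

/-- **THE DEEP CHILDREN ARE INHABITED AT `(J9t-13o5d73, 5)` modulo two analytic numerics**: the common outer hypotheses of
`Theorems.NonSurjCornerKolyZDeep` (23046) and `Theorems.NonSurjCornerTwinMuAnDeep` (23047) hold at `E` given `hr : r_an = 1` and
`hSha : ∃ s, shaAn E = s ∧ 0 < ord₅ s` (numerics, kit j331491 ∕ j331690 at 38 digits: `L'(E,1) = 28.4533413…`, generator of height `ĥ = 9.6341300…`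
saturated at every prime `≤ 500`, `X = L'(E,1)·#tors²∕(Ω·∏c) = 240.8532499…`, `#Ш(E)_an = X∕ĥ = 25.000000…`). [cite: Zywina2015, Thm. 1.4 (i = 9)]
[cite: GrossZagier1986, Thm. I.6.3 (the L'-value behind #Ш_an)] -/
theorem deepHypotheses (W : WeierstrassCurve ℚ) (hW : W = ⟨0, 1, 0, -34107376, -151657428560⟩) [W.IsElliptic]
    [W.IsGloballyMinimal] [Fact (Nat.Prime 5)] (hr : W.analyticRank = 1)
    (hSha : ∃ s : ℚ, shaAn W = (s : ℂ) ∧ 0 < padicValRat 5 s) :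
    ClassX11b W 5 ∧ ¬ Surj W 5 ∧ ((5 : ℕ) = 5 ∨ (5 : ℕ) = 7) ∧
      (5 : ℕ) ∣ padicValInt 5 W.minimalDiscriminantInt ∧ ¬ Ram W 5 ∧
      (∃ s : ℚ, shaAn W = (s : ℂ) ∧ 0 < padicValRat 5 s) :=
  ⟨classX11b_five W hW hr, not_surj_five W hW, Or.inl rfl, dvd_padicValInt_five W hW, not_ram_five W hW, hSha⟩

/-- **What 23047 says at `J9t-13o5d73`** (its inner statement at this pair, for every Heegner field `K` with `L(E^{(d_K)},1) ≠ 0` and every model of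
the twist), from the decl BY NAME and the two analytic binders — the shape lane B's twin tables certify field by field. Nothing is asserted:
the decl is a hypothesis. [cite: GreenbergLNM1716, §1 Conj. 1.11 (p. 61) (shape)] -/
theorem twinMuAnDeep_at (h : NonSurjCornerTwinMuAnDeep)
    (W : WeierstrassCurve ℚ) (hW : W = ⟨0, 1, 0, -34107376, -151657428560⟩) [W.IsElliptic] [W.IsGloballyMinimal]
    [Fact (Nat.Prime 5)] (hr : W.analyticRank = 1) (hSha : ∃ s : ℚ, shaAn W = (s : ℂ) ∧ 0 < padicValRat 5 s)
    (K : Type) [Field K] [NumberField K] (Wd : WeierstrassCurve ℚ) [Wd.IsElliptic] [Wd.IsGloballyMinimal] (Cd : VariableChange ℚ)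
    (hK : IsImaginaryQuadratic K) (hH : SatisfiesHeegnerHypothesis (W.conductorNorm ℤ) K)
    (hL : (W.quadraticTwist (NumberField.discr K : ℚ)).entireLFunction 1 ≠ 0)
    (hCd : Cd • W.quadraticTwist (NumberField.discr K : ℚ) = Wd)
    (hXd : ClassX11a Wd 5) (hnsd : ¬ Surj Wd 5)
    (hvd : (5 : ℕ) ∣ padicValInt 5 Wd.minimalDiscriminantInt)
    {N : ℕ} [NeZero N] (f : CuspForm (CongruenceSubgroup.Gamma0 N) 2) (hf : ModularForms.IsNewformOf Wd f)
    (ϖ : ℚ) (hϖ : (ϖ : ℝ) * Wd.realPeriodRat = ModularForms.plusPeriod f)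
    (a : ℚ_[5]) (L : PowerSeries ℚ_[5])
    (ha₁ : Wd.HasSplitMultiplicativeReductionAtPrime 5 → a = 1) (ha₂ : ¬ Wd.HasSplitMultiplicativeReductionAtPrime 5 → a = -1)
    (hLf : IsMultPAdicLFunctionOf f 5 a L) :
    ∃ n : ℕ, ‖PowerSeries.coeff n (PowerSeries.C ((ϖ : ℚ) : ℚ_[5]) * L)‖ = 1 := by
  obtain ⟨hX, hns, h57, hv, hram, hs⟩ := deepHypotheses W hW hr hSha
  exact h W 5 hX hns h57 hv hram hs K Wd Cd hK hH hL hCd hXd hnsd hvd f hf ϖ hϖ a L ha₁ ha₂ hLf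

end Tm13o5d73

/-! ## Kernel pair facts of `E₀ = [0, 0, 0, -298683308, -5358002282132]` (`J9t-231o115d47`, `j = J₉(-231/115)`, `N = 783326067760 = 2⁴·5·23·47²·439²`) at `p = 5` -/

namespace Tm231o115d47

/-- `Δ(E₀) = -10696590136714768204549600000`. [cite: SilvermanAEC2009, III.1] -/
theorem Δ_eq : (⟨0, 0, 0, -298683308, -5358002282132⟩ : WeierstrassCurve ℤ).Δ = -10696590136714768204549600000 := by
  decide

/-- `Δ(E₀) = -2⁸·5⁵·23⁵·47⁶·439²` (bad primes `2, 5, 23, 47, 439`; `N = 2⁴·5·23·47²·439²`). [cite: SilvermanAEC2009, VII.5 Prop. 5.1] -/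
theorem Δ_eq_factored : (⟨0, 0, 0, -298683308, -5358002282132⟩ : WeierstrassCurve ℤ).Δ =
    -(2 ^ 8 * 5 ^ 5 * 23 ^ 5 * 47 ^ 6 * 439 ^ 2) := by
  rw [Δ_eq]; norm_num

/-- `c₄(E₀) = 14336798784 = 2⁶·3·7·11·47²·439`. [cite: SilvermanAEC2009, III.1] -/
theorem c₄_eq : (⟨0, 0, 0, -298683308, -5358002282132⟩ : WeierstrassCurve ℤ).c₄ = 14336798784 := by
  decide

/-- `#Ẽ₀(𝔽_3) = 4` (`a_3 = 0`), kernel-decided. [cite: SilvermanAEC2009, V.2] -/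
theorem card_F3 : Nat.card (((⟨0, 0, 0, -298683308, -5358002282132⟩ : WeierstrassCurve ℤ).map
    (Int.castRingHom (ZMod 3))).toAffine.Point) = 4 := by
  rw [@natCard_point_eq_one_add_card (ZMod 3) (@ZMod.instField 3 ⟨by norm_num⟩) _ _ _ (by decide)]
  decide

/-- `E` is an elliptic curve (`Δ ≠ 0`). [cite: SilvermanAEC2009, III.1] -/
theorem isElliptic (W : WeierstrassCurve ℚ) (hW : W = ⟨0, 0, 0, -298683308, -5358002282132⟩) : W.IsElliptic := by
  subst hW; exact isElliptic_of_discOf_ne_zero 0 0 0 (-298683308) (-5358002282132) (by decide +kernel)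

/-- The model is GLOBALLY MINIMAL: `|Δ| < 256¹²` and `q¹² ∤ Δ` for every prime `q < 256` (all `ord_q Δ ≤ 8`).
[cite: SilvermanAEC2009, VII.1 Remark 1.1] -/
theorem isGloballyMinimal (W : WeierstrassCurve ℚ) (hW : W = ⟨0, 0, 0, -298683308, -5358002282132⟩) : W.IsGloballyMinimal := by
  subst hW
  exact CornerSeven.isGloballyMinimal_of_silverman_bounded 0 0 0 (-298683308) (-5358002282132) 256
    (by decide +kernel) (by decide +kernel) (by decide +kernel)

/-- The tree's integral model of `E` is `E₀`. [folklore] -/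
theorem integralModelInt_eq (W : WeierstrassCurve ℚ) (hW : W = ⟨0, 0, 0, -298683308, -5358002282132⟩) [W.IsGloballyMinimal] :
    integralModelInt W = ⟨0, 0, 0, -298683308, -5358002282132⟩ := by
  subst hW; exact integralModelInt_eq_of_map_eq _ (map_mk_int _ _ _ _ _)

/-- `E` as the base change of its integer model. [folklore] -/
theorem eq_baseChange (W : WeierstrassCurve ℚ) (hW : W = ⟨0, 0, 0, -298683308, -5358002282132⟩) :
    W = (⟨0, 0, 0, -298683308, -5358002282132⟩ : WeierstrassCurve ℤ).baseChange ℚ := by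
  rw [hW]; ext <;> simp [WeierstrassCurve.baseChange, WeierstrassCurve.map]

/-- **Multiplicative reduction at `5`** (`5 ∣ Δ`, `5 ∤ c₄`). [cite: SilvermanAEC2009, VII.5 Prop. 5.1(b)] -/
theorem mult_five (W : WeierstrassCurve ℚ) (hW : W = ⟨0, 0, 0, -298683308, -5358002282132⟩) [W.IsElliptic] [W.IsGloballyMinimal]
    [Fact (Nat.Prime 5)] : Mult W 5 :=
  hasMultiplicativeReductionAtPrime_of_intModel (integralModelInt_eq W hW) 5
    (by rw [Δ_eq]; decide) (by rw [c₄_eq]; decide)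

/-- `ord₅ Δ_min(E) = 5`. [cite: SilvermanAEC2009, VII.5 Prop. 5.1(b)] -/
theorem padicValInt_five (W : WeierstrassCurve ℚ) (hW : W = ⟨0, 0, 0, -298683308, -5358002282132⟩) [W.IsElliptic] [W.IsGloballyMinimal]
    [Fact (Nat.Prime 5)] : padicValInt 5 W.minimalDiscriminantInt = 5 := by
  rw [minimalDiscriminantInt_eq (integralModelInt_eq W hW), Δ_eq]
  exact padicValInt_eq_of_dvd_of_not_dvd 5 (by decide) (by decide)

/-- The crux binder **`5 ∣ ord₅ Δ_min(E)`** (`5 = 5·1`). [cite: SilvermanAEC2009, VII.5 Prop. 5.1(b)] -/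
theorem dvd_padicValInt_five (W : WeierstrassCurve ℚ) (hW : W = ⟨0, 0, 0, -298683308, -5358002282132⟩) [W.IsElliptic] [W.IsGloballyMinimal]
    [Fact (Nat.Prime 5)] : (5 : ℕ) ∣ padicValInt 5 W.minimalDiscriminantInt := by
  have h := padicValInt_five W hW
  omega

/-- `ord_{23} Δ_min(E) = 5` (the second multiplicative prime; `5 ∣ 5`: no (ram) witness). [cite: SilvermanAEC2009, VII.5 Prop. 5.1(b)] -/
theorem padicValInt_23 (W : WeierstrassCurve ℚ) (hW : W = ⟨0, 0, 0, -298683308, -5358002282132⟩) [W.IsElliptic] [W.IsGloballyMinimal] :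
    padicValInt 23 W.minimalDiscriminantInt = 5 := by
  haveI : Fact (Nat.Prime 23) := ⟨by norm_num⟩
  rw [minimalDiscriminantInt_eq (integralModelInt_eq W hW), Δ_eq]
  exact padicValInt_eq_of_dvd_of_not_dvd 23 (by decide) (by decide)

/-- **`E[5]` is irreducible**: Frobenius no-root witness at the good prime `ℓ = 3` (`a₃ = 0`, `X² + 3` root-free mod `5`;
Mazur 1978 Prop. 6.3 (1)). [cite: Mazur1978, §6 Prop. 6.3 (1) (p. 153)] -/
theorem irr_five (W : WeierstrassCurve ℚ) (hW : W = ⟨0, 0, 0, -298683308, -5358002282132⟩) [W.IsElliptic] [W.IsGloballyMinimal]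
    [Fact (Nat.Prime 5)] : Irr W 5 :=
  haveI : Fact (Nat.Prime 3) := ⟨by norm_num⟩
  hasIrreducibleModPGaloisRep_of_intModel_of_noroot (integralModelInt_eq W hW) 5 3
    (by decide) (by rw [Δ_eq]; decide) card_F3
    (of_decide_eq_true rfl)

/-- **Every prime of multiplicative reduction of `E` is one of `5`, `23`**: it divides `Δ = -2⁸·5⁵·23⁵·47⁶·439²`, and `2`, `47`, `439` are additive
(`q ∣ Δ`, `q ∣ c₄` at the globally minimal model). [cite: SilvermanAEC2009, VII.5 Prop. 5.1] -/
theorem mem_of_mult (W : WeierstrassCurve ℚ) (hW : W = ⟨0, 0, 0, -298683308, -5358002282132⟩) [W.IsElliptic] [W.IsGloballyMinimal]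
    {ℓ : ℕ} [hℓ : Fact ℓ.Prime] (hm : Mult W ℓ) : ℓ = 5 ∨ ℓ = 23 := by
  have hI := integralModelInt_eq W hW
  have hdvd : (ℓ : ℤ) ∣ (⟨0, 0, 0, -298683308, -5358002282132⟩ : WeierstrassCurve ℤ).Δ := by
    by_contra hnd
    exact (hasGoodReductionAtPrime_of_not_dvd W ℓ (by rwa [minimalDiscriminantInt_eq hI])).not_hasMultiplicativeReduction _ hm
  rw [Δ_eq_factored, Int.dvd_neg, Int.natCast_dvd] at hdvd
  simp only [Int.natAbs_mul, Int.natAbs_pow] at hdvd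
  have hp := hℓ.out
  have hadd : ∀ q : ℕ, [Fact q.Prime] → (q : ℤ) ∣ (⟨0, 0, 0, -298683308, -5358002282132⟩ : WeierstrassCurve ℤ).Δ →
      (q : ℤ) ∣ (⟨0, 0, 0, -298683308, -5358002282132⟩ : WeierstrassCurve ℤ).c₄ → ¬ Mult W q :=
    fun q _ hΔ hc ↦ not_hasMultiplicativeReductionAtPrime_of_intModel_of_dvd_of_dvd hI q hΔ hc
  rcases (Nat.Prime.dvd_mul hp).mp hdvd with hdvd | h439
  · rcases (Nat.Prime.dvd_mul hp).mp hdvd with hdvd | h47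
    · rcases (Nat.Prime.dvd_mul hp).mp hdvd with hdvd | h23
      · rcases (Nat.Prime.dvd_mul hp).mp hdvd with hdvd | h5
        · exfalso
          have h' : ℓ = 2 := (Nat.prime_dvd_prime_iff_eq hp (by norm_num : Nat.Prime 2)).mp (hp.dvd_of_dvd_pow hdvd)
          subst h'
          exact hadd 2 (by rw [Δ_eq]; decide) (by rw [c₄_eq]; decide) hm
        · exact Or.inl ((Nat.prime_dvd_prime_iff_eq hp (by norm_num : Nat.Prime 5)).mp (hp.dvd_of_dvd_pow h5))
      · exact Or.inr ((Nat.prime_dvd_prime_iff_eq hp (by norm_num : Nat.Prime 23)).mp (hp.dvd_of_dvd_pow h23))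
    · exfalso
      have h' : ℓ = 47 := (Nat.prime_dvd_prime_iff_eq hp (by norm_num : Nat.Prime 47)).mp (hp.dvd_of_dvd_pow h47)
      subst h'
      exact hadd 47 (by rw [Δ_eq]; decide) (by rw [c₄_eq]; decide) hm
  · exfalso
    have h' : ℓ = 439 := (Nat.prime_dvd_prime_iff_eq hp (by norm_num : Nat.Prime 439)).mp (hp.dvd_of_dvd_pow h439)
    subst h'
    exact hadd 439 (by rw [Δ_eq]; decide) (by rw [c₄_eq]; decide) hm

/-- The crux binder **no (ram) witness at `5`**: the only multiplicative prime `ℓ ≠ 5` is `23`, with `ord_{23} Δ_min = 5`,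
divisible by `5`. [cite: SkinnerUrban2014, Thm. 2 (p. 3), hypothesis (ram)] -/
theorem not_ram_five (W : WeierstrassCurve ℚ) (hW : W = ⟨0, 0, 0, -298683308, -5358002282132⟩) [W.IsElliptic] [W.IsGloballyMinimal]
    [Fact (Nat.Prime 5)] : ¬ Ram W 5 := by
  rintro ⟨ℓ, hℓ, hne, hm, hv⟩
  rcases mem_of_mult W hW hm with rfl | rfl
  · exact hne rfl
  · apply hv
    have h := padicValInt_23 W hW
    have hF : hℓ = ⟨by norm_num⟩ := Subsingleton.elim _ _
    subst hF
    omega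

/-- **`j(E) = J₉(-231/115)`** on Zywina's `X_{G₉}` j-line: `j = c₄³/Δ = −5541156504576/20113571875 = t³(t² + 5t + 40)` at `t = -231/115`.
[cite: Zywina2015, §1.3 (J₉) and Thm. 1.4 (arXiv:1508.07660)] -/
theorem j_eq_J9 (W : WeierstrassCurve ℚ) (hW : W = ⟨0, 0, 0, -298683308, -5358002282132⟩) [W.IsElliptic] :
    W.j = (-231 / 115 : ℚ) ^ 3 * ((-231 / 115 : ℚ) ^ 2 + 5 * (-231 / 115) + 40) := by
  have hW' := eq_baseChange W hW
  subst hW'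
  rw [j_baseChange_int, c₄_eq, Δ_eq]; norm_num

/-- **`ρ̄_{E,5}` is NOT onto** — a THEOREM: `E` is non-CM (multiplicative at `5`) and `j(E) = J₉(-231/115)`, so the tree's
`zywina2015_thm14_not_surjective_five_of_j_eq_J9_holds` applies. [cite: Zywina2015, Thm. 1.4 (i = 9) (arXiv:1508.07660)]
[cite: SilvermanATAEC1994, Thm. II.6.4] -/
theorem not_surj_five (W : WeierstrassCurve ℚ) (hW : W = ⟨0, 0, 0, -298683308, -5358002282132⟩) [W.IsElliptic] [W.IsGloballyMinimal]
    [Fact (Nat.Prime 5)] : ¬ Surj W 5 :=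
  zywina2015_thm14_not_surjective_five_of_j_eq_J9_holds W
    (fun hCM ↦ not_hasMultiplicativeReductionAtPrime_of_hasCM W hCM 5 (mult_five W hW)) (-231 / 115) (j_eq_J9 W hW)

/-- **`(E, 5) ∈ X11b`** given `r_an(E) = 1` (`hr`; numerics: root number `−1`, `L'(E,1) = 19.8265473…`, `ellrank` = `[1,1,0]`, lane B g15 kit j331690).
[cite: Miller2011LMS, §1] -/
theorem classX11b_five (W : WeierstrassCurve ℚ) (hW : W = ⟨0, 0, 0, -298683308, -5358002282132⟩) [W.IsElliptic] [W.IsGloballyMinimal]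
    [Fact (Nat.Prime 5)] (hr : W.analyticRank = 1) : ClassX11b W 5 :=
  ⟨hr, by decide, mult_five W hW, irr_five W hW⟩

/-- **THE DEEP CHILDREN ARE INHABITED AT `(J9t-231o115d47, 5)` modulo two analytic numerics**: the common outer hypotheses of
`Theorems.NonSurjCornerKolyZDeep` (23046) and `Theorems.NonSurjCornerTwinMuAnDeep` (23047) hold at `E` given `hr : r_an = 1` and
`hSha : ∃ s, shaAn E = s ∧ 0 < ord₅ s` (numerics, kit j331491 ∕ j331690 at 38 digits: `L'(E,1) = 19.8265473…`, generator of height `ĥ = 23.8247627…`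
saturated at every prime `≤ 500`, `X = L'(E,1)·#tors²∕(Ω·∏c) = 595.6190680…`, `#Ш(E)_an = X∕ĥ = 25.000000…`). [cite: Zywina2015, Thm. 1.4 (i = 9)]
[cite: GrossZagier1986, Thm. I.6.3 (the L'-value behind #Ш_an)] -/
theorem deepHypotheses (W : WeierstrassCurve ℚ) (hW : W = ⟨0, 0, 0, -298683308, -5358002282132⟩) [W.IsElliptic]
    [W.IsGloballyMinimal] [Fact (Nat.Prime 5)] (hr : W.analyticRank = 1)
    (hSha : ∃ s : ℚ, shaAn W = (s : ℂ) ∧ 0 < padicValRat 5 s) :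
    ClassX11b W 5 ∧ ¬ Surj W 5 ∧ ((5 : ℕ) = 5 ∨ (5 : ℕ) = 7) ∧
      (5 : ℕ) ∣ padicValInt 5 W.minimalDiscriminantInt ∧ ¬ Ram W 5 ∧
      (∃ s : ℚ, shaAn W = (s : ℂ) ∧ 0 < padicValRat 5 s) :=
  ⟨classX11b_five W hW hr, not_surj_five W hW, Or.inl rfl, dvd_padicValInt_five W hW, not_ram_five W hW, hSha⟩

/-- **What 23047 says at `J9t-231o115d47`** (its inner statement at this pair, for every Heegner field `K` with `L(E^{(d_K)},1) ≠ 0` and every model of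
the twist), from the decl BY NAME and the two analytic binders — the shape lane B's twin tables certify field by field. Nothing is asserted:
the decl is a hypothesis. [cite: GreenbergLNM1716, §1 Conj. 1.11 (p. 61) (shape)] -/
theorem twinMuAnDeep_at (h : NonSurjCornerTwinMuAnDeep)
    (W : WeierstrassCurve ℚ) (hW : W = ⟨0, 0, 0, -298683308, -5358002282132⟩) [W.IsElliptic] [W.IsGloballyMinimal]
    [Fact (Nat.Prime 5)] (hr : W.analyticRank = 1) (hSha : ∃ s : ℚ, shaAn W = (s : ℂ) ∧ 0 < padicValRat 5 s)
    (K : Type) [Field K] [NumberField K] (Wd : WeierstrassCurve ℚ) [Wd.IsElliptic] [Wd.IsGloballyMinimal] (Cd : VariableChange ℚ)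
    (hK : IsImaginaryQuadratic K) (hH : SatisfiesHeegnerHypothesis (W.conductorNorm ℤ) K)
    (hL : (W.quadraticTwist (NumberField.discr K : ℚ)).entireLFunction 1 ≠ 0)
    (hCd : Cd • W.quadraticTwist (NumberField.discr K : ℚ) = Wd)
    (hXd : ClassX11a Wd 5) (hnsd : ¬ Surj Wd 5)
    (hvd : (5 : ℕ) ∣ padicValInt 5 Wd.minimalDiscriminantInt)
    {N : ℕ} [NeZero N] (f : CuspForm (CongruenceSubgroup.Gamma0 N) 2) (hf : ModularForms.IsNewformOf Wd f)
    (ϖ : ℚ) (hϖ : (ϖ : ℝ) * Wd.realPeriodRat = ModularForms.plusPeriod f)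
    (a : ℚ_[5]) (L : PowerSeries ℚ_[5])
    (ha₁ : Wd.HasSplitMultiplicativeReductionAtPrime 5 → a = 1) (ha₂ : ¬ Wd.HasSplitMultiplicativeReductionAtPrime 5 → a = -1)
    (hLf : IsMultPAdicLFunctionOf f 5 a L) :
    ∃ n : ℕ, ‖PowerSeries.coeff n (PowerSeries.C ((ϖ : ℚ) : ℚ_[5]) * L)‖ = 1 := by
  obtain ⟨hX, hns, h57, hv, hram, hs⟩ := deepHypotheses W hW hr hSha
  exact h W 5 hX hns h57 hv hram hs K Wd Cd hK hH hL hCd hXd hnsd hvd f hf ϖ hϖ a L ha₁ ha₂ hLf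

end Tm231o115d47

end Summit.BirchSwinnertonDyer.BirchSwinnertonDyer.Theorems.CornerFive

end
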